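import Summits.QuantumFields.BalabanUV.T4Continuum.Support.NE7EJFlatSecular

/-!
# NE7EJFlatSecularB — row NE7 (node U5), candidate route HOM, variant H1L-EJ, item EJ-1b′ (T1)–(T3′): LENS 1's THEOREM B AT THE SECULAR LEVEL —
# the identity `S_B := Σ_n w_n(1 + 2u_n) = 1 − 4AB` (so `S_B ≤ 1` on `[0,1]²` with equality EXACTLY on the axes), and the affine family
# `S_c = 1 + (4∕c − 2)(A+B) − (16∕c − 4)AB` showing that `c = 2` is extremal

Lineage `b2b-balaban-t4-ne7-p2` (CRUX PROVER NE7 #2 = C-HOM°'s kernel hand), generation 82; file 128.  Imports file 117 `NE7EJFlatSecular` only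
(its alias data `uu ∕ ww` on `Bool × Bool`, `sum_alias`, the trigonometric dictionary `sin_sq_half_*`).

SOURCE (lens 1 = `t4-ne7-idea-1` gen 73, toy P-EJ-15 (ii), `t4/ideate/NE7/lens1-g73/FLATPADE-NOTE.md` d2ccf99438315edd; [NE7IDEA1-G73-INBOX]
L.53664 ∕ L.53668 → p2: «THEOREM B (SHARP, two lines) — EF^flat ≥ Hess²(2+Hess)⁻¹ = φ₂(Hess)(1+½Hess) ⇔ 4A†A ≤ 2(2−Δ_plaq)⁻¹ ⇔ 1 − S = 4AB =
¼sin²p₁sin²p₂ EXACTLY (h = 1 + 2u; S = (1−2A)(1−2B) + 2A(1−2B) + 2B(1−2A)); equality on axis blocks; x²∕(c+x) fails ∀ c < 2 (S − 1 =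
(4∕c−2)(A+B) − (16∕c−4)AB), (1+δ)x²∕(2+x) fails ∀ δ > 0 (S(π∕2,0) = 1∕(1−δ)); 1 + 2u the maximal polynomial weight» and «Theorem B is a second
sharp flat inequality whose whole proof is the polynomial identity Σ_n w_n(1 + 2u_n) = 1 − 4x₁y₁x₂y₂ in ℚ[y₁, y₂] plus the alias-block reduction
you already typed»; d = 2, L = 2, one RG step, FLAT abelian toy — her words «never the NE7 estimate»).  In file 117's variables (`y_μ = sin²(p_μ∕2)`,
`A = y₁(1−y₁) = ¼sin²p₁`, `B = y₂(1−y₂)`, alias labels `n ∈ Bool × Bool`, `u_n = uu`, `w_n = ww = |t_n|²`), THEOREM B's weight `g_B(ω) = 2∕(2+ω)`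
has inverse `1 + ω∕2 = 1 + 2u` at `ω = 4u` (file 127 `inv_gB_four_mul`), so file 118's rank-one criterion `Σ_n |t_n|²∕g(ω_n) ≤ 1` becomes
`S_B := Σ_n w_n(1 + 2u_n) ≤ 1`.  THIS FILE:
* §1 `sum_ww_mul_uu` (`Σ_n w_n u_n = (A+B) − 4AB`), `sum_ww_eq_AB` (`Σ_n w_n = (1−2A)(1−2B)`), `secularSB` and **`secularSB_eq`** (`S_B = 1 − 4AB`, by
  `ring`), **`secularSB_le_one`** on `[0,1]²`, **`secularSB_eq_one_iff`** (`= 1 ↔` a coordinate is `0` or `1`), `secularSB_lt_one` off the axes,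
  `secularSB_axis` (`= 1` on the axes for EVERY value of the other coordinate — THEOREM B is sharp on every axis alias block, like (hh)).
* §2 the trigonometric form: **`secularSB_trig`** (`S_B(p) = 1 − ¼sin²p₁sin²p₂` — her «1 − S = 4AB = ¼sin²p₁sin²p₂ EXACTLY»), `secularSB_le_one_trig`,
  `secularSB_eq_one_trig_iff` (`↔ sin p₁ = 0 ∨ sin p₂ = 0`).
* §3 the affine family `secularSC c` (weight `g_c = c∕(c+ω)`, inverse `1 + 4u∕c`): **`secularSC_eq`** (her closed form), `secularSC_two` (`c = 2` is
  THEOREM B), **`one_lt_secularSC_axis`** (for `0 < c < 2` the criterion FAILS already on the axis blocks `y₂ = 0`, `y₁ ∈ (0,1)`: `S_c = 1 + (4∕c−2)A > 1`)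
  — «x²∕(c+x) fails ∀ c < 2»; `secularSC_le_one` for `c ≥ 2` on `[0,1]²` (weaker weights pass); and her δ-witness **`secular_delta_witness`**: at
  `(y₁,y₂) = (½,0)` (`p = (π∕2, 0)`) the weight of `(1+δ)x²∕(2+x)` gives `Σ_n w_n(2+ω_n)∕(2−δω_n) = 1∕(1−δ)` (`> 1` for `0 < δ < 1`).
The operator-level statements (per-fibre inequality, «4AᵀA ≤ 2(2+K)⁻¹» on every even torus, the 1-form END) are files 129–131.

HONEST FRAMING: [folklore] real algebra in two variables (identities by `ring` after file 117's four-term expansions, signs by `nlinarith`); the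
OBJECTS are lens 1's flat toy; nothing of Bałaban's is instantiated; no d = 4 statement, no curved background, nothing at ε > 0; NOT a letter move
(PRICING-NE7 v56 §413: toy rungs at zero letter); T-50-10 honoured.  NE7 NOT PRINTED ∕ NOT PROVED; spine 0∕9; FIXED FINITE T⁴, rung (B)+1; NOT
infinite volume, NOT mass gap, NOT Clay.  HONEST DEPENDENCY: continuum YM on T⁴ ⇐ BetaPertH ∧ nine spine estimates (0/9 proved); BetaPertH ⇐ (D1) ∧
(D4) ∧ CAP+tail; G-an2-4 gates asym, D1 and NE2/3/4.
-/

noncomputable section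

open Finset Real

namespace Summit.QuantumFields.BalabanUV.T4Continuum.NE7EJFlatSecularB

open NE7EJFlatSecular

/-! ### §1 THEOREM B's secular sum `S_B = Σ_n w_n(1 + 2u_n) = 1 − 4AB` -/

/-- `Σ_n w_n·u_n = (A + B) − 4AB` with `A = y₁(1−y₁)`, `B = y₂(1−y₂)`. [folklore] -/
theorem sum_ww_mul_uu (y₁ y₂ : ℝ) :
    ∑ n, ww y₁ y₂ n * uu y₁ y₂ n = (y₁ * (1 - y₁) + y₂ * (1 - y₂)) - 4 * (y₁ * (1 - y₁)) * (y₂ * (1 - y₂)) := by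
  rw [sum_alias]; unfold ww uu; simp only [Bool.false_eq_true, ↓reduceIte]; ring

/-- `Σ_n w_n = (1 − 2A)(1 − 2B)` (file 117's `sum_ww_eq` in the `A, B` variables). [folklore] -/
theorem sum_ww_eq_AB (y₁ y₂ : ℝ) : ∑ n, ww y₁ y₂ n = (1 - 2 * (y₁ * (1 - y₁))) * (1 - 2 * (y₂ * (1 - y₂))) := by
  rw [sum_ww_eq]; unfold G; ring

/-- **THEOREM B's secular sum** `S_B(y₁,y₂) := Σ_n w_n·(1 + 2u_n)` (file 118's criterion sum `Σ_n |t_n|²∕g_B(ω_n)`, `g_B⁻¹(4u) = 1 + 2u`). [folklore] -/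
def secularSB (y₁ y₂ : ℝ) : ℝ := ∑ n, ww y₁ y₂ n * (1 + 2 * uu y₁ y₂ n)

/-- **THE IDENTITY** (lens 1: «1 − S = 4AB EXACTLY»): `S_B = 1 − 4·A·B`. [folklore] -/
theorem secularSB_eq (y₁ y₂ : ℝ) : secularSB y₁ y₂ = 1 - 4 * (y₁ * (1 - y₁)) * (y₂ * (1 - y₂)) := by
  unfold secularSB
  rw [sum_alias]; unfold ww uu; simp only [Bool.false_eq_true, ↓reduceIte]; ring

/-- her displayed three-term form: `S_B = (1−2A)(1−2B) + 2A(1−2B) + 2B(1−2A)`. [folklore] -/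
theorem secularSB_eq' (y₁ y₂ : ℝ) :
    secularSB y₁ y₂ = (1 - 2 * (y₁ * (1 - y₁))) * (1 - 2 * (y₂ * (1 - y₂))) + 2 * (y₁ * (1 - y₁)) * (1 - 2 * (y₂ * (1 - y₂)))
      + 2 * (y₂ * (1 - y₂)) * (1 - 2 * (y₁ * (1 - y₁))) := by
  rw [secularSB_eq]; ring

/-- **`S_B ≤ 1` on `[0,1]²`** — THEOREM B's secular criterion. [folklore] -/
theorem secularSB_le_one {y₁ y₂ : ℝ} (h₁ : y₁ ∈ Set.Icc (0:ℝ) 1) (h₂ : y₂ ∈ Set.Icc (0:ℝ) 1) : secularSB y₁ y₂ ≤ 1 := by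
  rw [secularSB_eq]
  obtain ⟨hA0, -⟩ := mul_one_sub_mem h₁
  obtain ⟨hB0, -⟩ := mul_one_sub_mem h₂
  nlinarith [mul_nonneg hA0 hB0]

/-- `S_B ≥ 3∕4` on `[0,1]²` (`AB ≤ 1∕16`). [folklore] -/
theorem three_quarters_le_secularSB {y₁ y₂ : ℝ} (h₁ : y₁ ∈ Set.Icc (0:ℝ) 1) (h₂ : y₂ ∈ Set.Icc (0:ℝ) 1) : 3 / 4 ≤ secularSB y₁ y₂ := by
  rw [secularSB_eq]
  obtain ⟨hA0, hA⟩ := mul_one_sub_mem h₁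
  obtain ⟨hB0, hB⟩ := mul_one_sub_mem h₂
  nlinarith [mul_le_mul hA hB hB0 (by norm_num : (0:ℝ) ≤ 1 / 4)]

/-- **THE EQUALITY SET**: on `[0,1]²`, `S_B = 1 ↔ (y₁ = 0 ∨ y₁ = 1) ∨ (y₂ = 0 ∨ y₂ = 1)` (an axis alias block). [folklore] -/
theorem secularSB_eq_one_iff (y₁ y₂ : ℝ) : secularSB y₁ y₂ = 1 ↔ (y₁ = 0 ∨ y₁ = 1) ∨ (y₂ = 0 ∨ y₂ = 1) := by
  rw [secularSB_eq, ← mul_one_sub_eq_zero_iff, ← mul_one_sub_eq_zero_iff]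
  constructor
  · intro h
    have h0 : 4 * (y₁ * (1 - y₁)) * (y₂ * (1 - y₂)) = 0 := by linarith
    rcases mul_eq_zero.mp h0 with h | h
    · rcases mul_eq_zero.mp h with h | h
      · norm_num at h
      · exact Or.inl h
    · exact Or.inr h
  · rintro (h | h) <;> simp [h]

/-- off the axes the inequality is STRICT. [folklore] -/
theorem secularSB_lt_one {y₁ y₂ : ℝ} (h₁ : y₁ ∈ Set.Ioo (0:ℝ) 1) (h₂ : y₂ ∈ Set.Ioo (0:ℝ) 1) : secularSB y₁ y₂ < 1 := by
  rw [secularSB_eq]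
  have hA : 0 < y₁ * (1 - y₁) := mul_pos h₁.1 (by linarith [h₁.2])
  have hB : 0 < y₂ * (1 - y₂) := mul_pos h₂.1 (by linarith [h₂.2])
  nlinarith [mul_pos hA hB]

/-- on the axis `y₂ = 0`: `S_B(y₁, 0) = 1` for EVERY `y₁` — THEOREM B is sharp on every axis alias block. [folklore] -/
theorem secularSB_axis (y₁ : ℝ) : secularSB y₁ 0 = 1 := by rw [secularSB_eq]; ring

/-- the other axis. [folklore] -/
theorem secularSB_axis' (y₂ : ℝ) : secularSB 0 y₂ = 1 := by rw [secularSB_eq]; ring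

/-- at the zone corner `y = (½,½)`: `S_B = ¾` (its minimum on `[0,1]²`). [folklore] -/
theorem secularSB_half_half : secularSB (1 / 2) (1 / 2) = 3 / 4 := by rw [secularSB_eq]; norm_num

/-! ### §2 The trigonometric form: `S_B(p) = 1 − ¼sin²p₁sin²p₂` -/

/-- **`S_B(p) = 1 − ¼sin²p₁·sin²p₂`** at `y_μ = sin²(p_μ∕2)` (lens 1's «1 − S = 4AB = ¼sin²p₁sin²p₂ EXACTLY»). [folklore] -/
theorem secularSB_trig (p₁ p₂ : ℝ) : secularSB (sin (p₁ / 2) ^ 2) (sin (p₂ / 2) ^ 2) = 1 - (1 / 4) * sin p₁ ^ 2 * sin p₂ ^ 2 := by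
  rw [secularSB_eq, sin_sq_half_mul, sin_sq_half_mul]; ring

/-- `S_B(p) ≤ 1` for all momenta. [folklore] -/
theorem secularSB_le_one_trig (p₁ p₂ : ℝ) : secularSB (sin (p₁ / 2) ^ 2) (sin (p₂ / 2) ^ 2) ≤ 1 := by
  rw [secularSB_trig]; nlinarith [sq_nonneg (sin p₁ * sin p₂)]

/-- **EQUALITY EXACTLY ON THE AXIS ALIAS BLOCKS**: `S_B(p) = 1 ↔ sin p₁ = 0 ∨ sin p₂ = 0`. [folklore] -/
theorem secularSB_eq_one_trig_iff (p₁ p₂ : ℝ) : secularSB (sin (p₁ / 2) ^ 2) (sin (p₂ / 2) ^ 2) = 1 ↔ sin p₁ = 0 ∨ sin p₂ = 0 := by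
  rw [secularSB_trig]
  constructor
  · intro h
    have : (sin p₁ * sin p₂) ^ 2 = 0 := by nlinarith
    exact mul_eq_zero.mp (pow_eq_zero_iff two_ne_zero |>.mp this)
  · rintro (h | h) <;> simp [h]

/-! ### §3 The affine family `g_c = c∕(c+ω)`: `c = 2` is extremal; the δ-witness -/

/-- the secular sum of the profile `x²∕(c+x)` (weight `g_c = c∕(c+ω)`, inverse `1 + ω∕c = 1 + 4u∕c`): `S_c := Σ_n w_n(1 + 4u_n∕c)`. [folklore] -/
def secularSC (c y₁ y₂ : ℝ) : ℝ := ∑ n, ww y₁ y₂ n * (1 + 4 * uu y₁ y₂ n / c)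

/-- **lens 1's closed form**: `S_c = 1 + (4∕c − 2)(A+B) − (16∕c − 4)AB`. [folklore] -/
theorem secularSC_eq (c y₁ y₂ : ℝ) :
    secularSC c y₁ y₂ = 1 + (4 / c - 2) * (y₁ * (1 - y₁) + y₂ * (1 - y₂)) - (16 / c - 4) * ((y₁ * (1 - y₁)) * (y₂ * (1 - y₂))) := by
  unfold secularSC
  rw [sum_alias]; unfold ww uu; simp only [Bool.false_eq_true, ↓reduceIte]; ring

/-- `c = 2` is THEOREM B: `S_2 = S_B`. [folklore] -/
theorem secularSC_two (y₁ y₂ : ℝ) : secularSC 2 y₁ y₂ = secularSB y₁ y₂ := by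
  unfold secularSC secularSB
  refine sum_congr rfl fun n _ => ?_
  ring

/-- **«x²∕(c+x) fails ∀ c < 2»**: for `0 < c < 2` the criterion fails ALREADY ON THE AXIS BLOCKS — `S_c(y₁, 0) = 1 + (4∕c − 2)·y₁(1−y₁) > 1` for
`y₁ ∈ (0,1)`. [folklore] -/
theorem one_lt_secularSC_axis {c y₁ : ℝ} (hc : 0 < c) (hc2 : c < 2) (h₁ : y₁ ∈ Set.Ioo (0:ℝ) 1) : 1 < secularSC c y₁ 0 := by
  rw [secularSC_eq]
  have hA : 0 < y₁ * (1 - y₁) := mul_pos h₁.1 (by linarith [h₁.2])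
  have hc' : 0 < 4 / c - 2 := by rw [sub_pos, lt_div_iff₀ hc]; linarith
  nlinarith [mul_pos hc' hA]

/-- on the axis the excess is exactly `(4∕c − 2)·A`. [folklore] -/
theorem secularSC_axis (c y₁ : ℝ) : secularSC c y₁ 0 = 1 + (4 / c - 2) * (y₁ * (1 - y₁)) := by
  rw [secularSC_eq]; ring

/-- for `c ≥ 2` the (weaker) weights pass: `S_c ≤ 1` on `[0,1]²`. [folklore] -/
theorem secularSC_le_one {c y₁ y₂ : ℝ} (hc : 2 ≤ c) (h₁ : y₁ ∈ Set.Icc (0:ℝ) 1) (h₂ : y₂ ∈ Set.Icc (0:ℝ) 1) : secularSC c y₁ y₂ ≤ 1 := by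
  rw [secularSC_eq]
  obtain ⟨hA0, hA⟩ := mul_one_sub_mem h₁
  obtain ⟨hB0, hB⟩ := mul_one_sub_mem h₂
  set A := y₁ * (1 - y₁) with hAdef
  set B := y₂ * (1 - y₂) with hBdef
  have hc0 : 0 < c := by linarith
  set t := 4 / c with ht
  have ht0 : 0 < t := by rw [ht]; positivity
  have ht2 : t ≤ 2 := by rw [ht, div_le_iff₀ hc0]; linarith
  have h16 : (16 : ℝ) / c = 4 * t := by rw [ht]; ring
  rw [h16]
  have hAB0 : 0 ≤ A * B := mul_nonneg hA0 hB0
  -- `8AB ≤ A + B` on `[0,¼]²`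
  have h8 : 8 * (A * B) ≤ A + B := by nlinarith
  rcases le_or_gt 1 t with h1 | h1
  · -- both terms are ≤ 0
    nlinarith [mul_nonneg (sub_nonneg.mpr h1) hAB0, mul_nonneg (by linarith : (0:ℝ) ≤ 2 - t) (add_nonneg hA0 hB0)]
  · -- `4(1−t)AB ≤ (1−t)(A+B)∕2` and `(t−2) + (1−t)∕2 = (t−3)∕2 ≤ 0`
    nlinarith [mul_nonneg (by linarith : (0:ℝ) ≤ 1 - t) (by linarith : (0:ℝ) ≤ A + B - 8 * (A * B)),
      mul_nonneg (by linarith : (0:ℝ) ≤ 3 - t) (add_nonneg hA0 hB0)]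

/-- **lens 1's δ-witness** («(1+δ)x²∕(2+x) fails ∀ δ > 0: S(π∕2,0) = 1∕(1−δ)»): the profile `(1+δ)φ_B` has weight `g = (2 − δω)∕(2 + ω)`; at the axis
block `(y₁,y₂) = (½,0)` (momentum `(π∕2, 0)`; there `ω_n = 4u_n = 2` on the two labels with `w_n = ¼`, and `w_n = 0` on the other two) the secular
sum is `Σ_n w_n(2+ω_n)∕(2−δω_n) = 1∕(1−δ)`. [folklore] -/
theorem secular_delta_witness (δ : ℝ) :
    ∑ n, ww (1 / 2) 0 n * ((2 + 4 * uu (1 / 2) 0 n) / (2 - δ * (4 * uu (1 / 2) 0 n))) = 1 / (1 - δ) := by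
  rw [sum_alias]; unfold ww uu; simp only [Bool.false_eq_true, ↓reduceIte]
  norm_num
  by_cases h : (1 : ℝ) - δ = 0
  · have h' : (2 : ℝ) - δ * 2 = 0 := by linarith
    simp [h, h']
  · have h' : (2 : ℝ) - δ * 2 ≠ 0 := fun h'' => h (by linarith)
    field_simp
    ring

/-- hence for `0 < δ < 1` that secular sum exceeds `1`: the weight of `(1+δ)φ_B` is NOT admissible (THEOREM B's constant is sharp). [folklore] -/
theorem one_lt_secular_delta_witness {δ : ℝ} (hδ : 0 < δ) (hδ1 : δ < 1) :
    1 < ∑ n, ww (1 / 2) 0 n * ((2 + 4 * uu (1 / 2) 0 n) / (2 - δ * (4 * uu (1 / 2) 0 n))) := by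
  rw [secular_delta_witness, lt_div_iff₀ (by linarith)]; linarith

end Summit.QuantumFields.BalabanUV.T4Continuum.NE7EJFlatSecularB

end
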